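import Summits.AtomisticToContinuum.Crystallization.Theorems.OverbindingBudgetAffineFarFieldCellLoose

/-!
# OverbindingBudget (2c) — part 27Vb-V(B2): the actual-cell sandwich (lens-4 g96; r1673 S3 «E_shape, E_det, E_cen»)

Support file, pure analysis on `ℝ³ = EuclideanSpace ℝ (Fin 3)`, no atlas.  In scheme B the cell of a far
site `p` is its TRUE Voronoi cell `K_p` in the perturbed configuration; by the charted `C²`-closeness of
the 18 relevant bisectors it is squeezed between the images, under ONE affine chart `x ↦ y_p + A_p x`, of a
slightly shrunk and a slightly swollen ideal cell.  This file turns such a squeeze into loose moment data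
(`IsLooseMomentCell`, part B1) with explicit constants — the instance (`θ_p` from the bisector data) is
part 27Vc; here the sandwich is a HYPOTHESIS:

* `norm_integral_sub_integral_le_sliver` — `I ⊆ K ⊆ O`, `‖h‖ ≤ M` on `O` ⟹ `‖∫_K h − ∫_I h‖ ≤ M(|O| − |I|)`;
* `volume_sandwich_ge/le`, `sliver_volume_le` — `|det A||K_in| ≤ |K| ≤ |det A||K_out|` and
  `|A K_out| − |A K_in| ≤ θ|K|` when `|K_out| ≤ (1 + θ)|K_in|`;
* ★ `isLooseMomentCell_of_sandwich` — if `affMap 0 y A '' K_in ⊆ K ⊆ affMap 0 y A '' K_out` with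
  `IsMomentCell K_in 0 σ₁ δ₁ μ₃ μ₄` (`0 ≤ μ₃, μ₄`), `K_in ⊆ K_out ⊆ closedBall 0 r`, `|K_out| ≤ (1 + θ)|K_in|`,
  `‖A − R‖ ≤ ε` for a linear isometry `R`, `‖A‖ ≤ a`, and `K` compact and star-shaped about `y`, then
  `IsLooseMomentCell K y (a r θ) σ (δ₁a² + 3|σ₁|ε(1+a) + 3|σ₁|θ + 3|σ₁ − σ| + (a r)²θ) (μ₃a³ + (a r)³θ)
  (μ₄a⁴ + (a r)⁴θ)` for any NOMINAL `σ` (take `σ = ν²/16`, the ideal value, so the `σ/2·Δg` terms of all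
  cells recombine into the discrete Laplacian of the REFERENCE crystal);
* ★ `cubic_clause_of_sandwich` — the structured cubic clause survives with `τ ↦ τa³ + (a r)³θ`.

Proof: every moment integral over `K` differs from the one over the inner image `I` by a sliver integral,
bounded by `sup · (|O| − |I|) ≤ sup · θ|K|`; the inner image carries exact data by
`IsMomentCell.image_affMap` / `cubic_clause_image_affMap` (part 163), rescaled from `|I|` to `|K| ≥ |I|`.
-/

namespace Summit.AtomisticToContinuum.Crystallization.Theorems.OverbindingBudgetAffineFarFieldCellSandwich

noncomputable section

open Set Filter MeasureTheory
open scoped Topology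
open Summit.AtomisticToContinuum.Crystallization.Theorems.OverbindingBudgetAffineFarFieldTaylor
open Summit.AtomisticToContinuum.Crystallization.Theorems.OverbindingBudgetAffineFarFieldCellTaylor
open Summit.AtomisticToContinuum.Crystallization.Theorems.OverbindingBudgetAffineFarFieldCellSymm
open Summit.AtomisticToContinuum.Crystallization.Theorems.OverbindingBudgetAffineFarFieldCellMove
open Summit.AtomisticToContinuum.Crystallization.Theorems.OverbindingBudgetAffineFarFieldCellAffine
open Summit.AtomisticToContinuum.Crystallization.Theorems.OverbindingBudgetAffineFarFieldCellLoose

local notation "E3" => EuclideanSpace ℝ (Fin 3)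

/-! ### Slivers: integrals over `K ∖ I` for `I ⊆ K ⊆ O` -/

/-- Sliver bound: if `I ⊆ K ⊆ O` (`I`, `K` compact, `O` of finite measure) and `‖h‖ ≤ M` on
`O`, then `‖∫_K h − ∫_I h‖ ≤ M·(|O| − |I|)`. -/
theorem norm_integral_sub_integral_le_sliver {I K O : Set E3} (hI : IsCompact I) (hK : IsCompact K)
    (hOfin : volume O ≠ ⊤) (hIK : I ⊆ K) (hKO : K ⊆ O)
    {F : Type*} [NormedAddCommGroup F] [NormedSpace ℝ F] {h : E3 → F}
    (hint : IntegrableOn h K) {M : ℝ} (hM : ∀ x ∈ O, ‖h x‖ ≤ M) :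
    ‖(∫ x in K, h x) - ∫ x in I, h x‖ ≤ M * ((volume O).toReal - (volume I).toReal) := by
  -- degenerate case `O = ∅`: everything vanishes
  rcases O.eq_empty_or_nonempty with hOe | ⟨x₀, hx₀⟩
  · have hKe : K = ∅ := subset_empty_iff.mp (by rw [← hOe]; exact hKO)
    have hIe : I = ∅ := subset_empty_iff.mp (by rw [← hKe]; exact hIK)
    simp [hKe, hIe, hOe]
  have hIm : MeasurableSet I := hI.measurableSet
  have hsd : (∫ x in K \ I, h x) = (∫ x in K, h x) - ∫ x in I, h x :=
    setIntegral_sdiff hIm hint hIK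
  rw [← hsd]
  have hKfin : volume K < ⊤ := hK.measure_lt_top
  have hKIfin : volume (K \ I) < ⊤ := lt_of_le_of_lt (measure_mono sdiff_subset) hKfin
  have h1 : ‖∫ x in K \ I, h x‖ ≤ M * (volume (K \ I)).toReal := by
    have h := norm_setIntegral_le_of_norm_le_const hKIfin
      (fun x hx => hM x (hKO ((sdiff_subset : K \ I ⊆ K) hx)))
    rwa [measureReal_def] at h
  have hM0 : 0 ≤ M := (norm_nonneg _).trans (hM x₀ hx₀)
  have h2 : (volume (K \ I)).toReal ≤ (volume O).toReal - (volume I).toReal := by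
    have hIfin : volume I ≠ ⊤ := hI.measure_lt_top.ne
    have e1 : volume (K \ I) = volume K - volume I := measure_sdiff hIK hIm.nullMeasurableSet hIfin
    have hIleK : volume I ≤ volume K := measure_mono hIK
    have hKleO : volume K ≤ volume O := measure_mono hKO
    rw [e1, ENNReal.toReal_sub_of_le hIleK hKfin.ne]
    have := ENNReal.toReal_mono hOfin hKleO
    linarith
  exact h1.trans (mul_le_mul_of_nonneg_left h2 hM0)

/-! ### The sandwich lemma -/

/-- Points of an affine image of a set inside `closedBall 0 r` are within `a·r` of the centre. -/
theorem norm_sub_le_of_mem_image_affMap {Kout : Set E3} {r : ℝ} (hball : Kout ⊆ Metric.closedBall 0 r)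
    (y : E3) (A : E3 ≃L[ℝ] E3) {a : ℝ} (ha : ‖(A : E3 →L[ℝ] E3)‖ ≤ a) {x : E3}
    (hx : x ∈ affMap 0 y A '' Kout) : ‖x - y‖ ≤ a * r := by
  obtain ⟨x₀, hx₀, rfl⟩ := hx
  rw [affMap_sub, sub_zero]
  have hr : ‖x₀‖ ≤ r := by simpa using hball hx₀
  have ha0 : 0 ≤ a := (norm_nonneg _).trans ha
  calc ‖A x₀‖ = ‖(A : E3 →L[ℝ] E3) x₀‖ := rfl
    _ ≤ ‖(A : E3 →L[ℝ] E3)‖ * ‖x₀‖ := ContinuousLinearMap.le_opNorm _ _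
    _ ≤ a * r := mul_le_mul ha hr (norm_nonneg _) ha0

/-- Volume of the sandwiched cell from below: `|det A|·|K_in| ≤ |K|`. -/
theorem volume_sandwich_ge {K Kin : Set E3} (hKin : IsCompact Kin) (hK : IsCompact K) (y : E3)
    (A : E3 ≃L[ℝ] E3) (hIK : affMap 0 y A '' Kin ⊆ K) :
    |(A : E3 →L[ℝ] E3).det| * (volume Kin).toReal ≤ (volume K).toReal := by
  rw [← volume_image_affMap_toReal 0 y A hKin.measurableSet]
  exact ENNReal.toReal_mono hK.measure_lt_top.ne (measure_mono hIK)

/-- Volume of the sandwiched cell from above: `|K| ≤ |det A|·|K_out|`. -/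
theorem volume_sandwich_le {K Kout : Set E3} (hKout : IsCompact Kout) (y : E3)
    (A : E3 ≃L[ℝ] E3) (hKO : K ⊆ affMap 0 y A '' Kout) :
    (volume K).toReal ≤ |(A : E3 →L[ℝ] E3).det| * (volume Kout).toReal := by
  rw [← volume_image_affMap_toReal 0 y A hKout.measurableSet]
  exact ENNReal.toReal_mono (hKout.image (continuous_affMap 0 y A)).measure_lt_top.ne
    (measure_mono hKO)

/-- The sliver volume in the sandwich: `|O| − |I| ≤ θ·|K|` when `|K_out| ≤ (1 + θ)|K_in|`. -/
theorem sliver_volume_le {K Kin Kout : Set E3} (hKin : IsCompact Kin) (hKout : IsCompact Kout)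
    (hK : IsCompact K) (y : E3) (A : E3 ≃L[ℝ] E3) {θ : ℝ} (hθ0 : 0 ≤ θ)
    (hθ : (volume Kout).toReal ≤ (1 + θ) * (volume Kin).toReal)
    (hIK : affMap 0 y A '' Kin ⊆ K) :
    (volume (affMap 0 y A '' Kout)).toReal - (volume (affMap 0 y A '' Kin)).toReal
      ≤ θ * (volume K).toReal := by
  rw [volume_image_affMap_toReal 0 y A hKout.measurableSet,
    volume_image_affMap_toReal 0 y A hKin.measurableSet]
  have hd0 : 0 ≤ |(A : E3 →L[ℝ] E3).det| := abs_nonneg _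
  have hlow := volume_sandwich_ge hKin hK y A hIK
  calc |(A : E3 →L[ℝ] E3).det| * (volume Kout).toReal - |(A : E3 →L[ℝ] E3).det| * (volume Kin).toReal
      = |(A : E3 →L[ℝ] E3).det| * ((volume Kout).toReal - (volume Kin).toReal) := by ring
    _ ≤ |(A : E3 →L[ℝ] E3).det| * (θ * (volume Kin).toReal) :=
        mul_le_mul_of_nonneg_left (by linarith) hd0
    _ = θ * (|(A : E3 →L[ℝ] E3).det| * (volume Kin).toReal) := by ring
    _ ≤ θ * (volume K).toReal := mul_le_mul_of_nonneg_left hlow hθ0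

/-- `|Σ_i B(e_i, e_i)| ≤ 3‖B‖`. -/
theorem abs_trace_le (B : E3 [×2]→L[ℝ] ℝ) : |∑ i : Fin 3, B (fun _ => e3 i)| ≤ 3 * ‖B‖ :=
  calc |∑ i : Fin 3, B (fun _ => e3 i)| ≤ ∑ i : Fin 3, |B (fun _ => e3 i)| :=
        Finset.abs_sum_le_sum_abs _ _
    _ ≤ ∑ _i : Fin 3, ‖B‖ := Finset.sum_le_sum (fun i _ => by
        rw [two_form_diag]; exact abs_two_form_e3_le B i i)
    _ = 3 * ‖B‖ := by simp

/-- `|B(v, v)| ≤ ‖B‖‖v‖²` for a bilinear form on the diagonal. -/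
theorem abs_two_form_diag_le (B : E3 [×2]→L[ℝ] ℝ) (v : E3) : |B (fun _ => v)| ≤ ‖B‖ * ‖v‖ ^ 2 := by
  have h := B.le_opNorm (fun _ => v)
  simp only [Finset.prod_const, Finset.card_univ, Fintype.card_fin] at h
  rwa [Real.norm_eq_abs] at h

/-- `|B(v, v, v)| ≤ ‖B‖‖v‖³` for a trilinear form on the diagonal. -/
theorem abs_three_form_diag_le (B : E3 [×3]→L[ℝ] ℝ) (v : E3) :
    |B (fun _ => v)| ≤ ‖B‖ * ‖v‖ ^ 3 := by
  have h := B.le_opNorm (fun _ => v)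
  simp only [Finset.prod_const, Finset.card_univ, Fintype.card_fin] at h
  rwa [Real.norm_eq_abs] at h

/-- ★ **The sandwich lemma.**  A compact cell `K`, star-shaped about `y`, squeezed between the affine
images under ONE map `x ↦ y + A x` of an exact inner ideal cell `K_in` (moment data about `0`) and an
outer set `K_out ⊇ K_in` inside `closedBall 0 r` with `|K_out| ≤ (1 + θ)|K_in|`, is a LOOSE moment cell
about `y` for any NOMINAL second moment `σ`, with explicit constants. -/
theorem isLooseMomentCell_of_sandwich {K Kin Kout : Set E3} {y : E3} {A : E3 ≃L[ℝ] E3}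
    {R : E3 ≃ₗᵢ[ℝ] E3} {σ σ₁ δ₁ μ₃ μ₄ ε a r θ : ℝ}
    (hin : IsMomentCell Kin 0 σ₁ δ₁ μ₃ μ₄) (hμ₃ : 0 ≤ μ₃) (hμ₄ : 0 ≤ μ₄)
    (hKout : IsCompact Kout) (hsub : Kin ⊆ Kout) (hball : Kout ⊆ Metric.closedBall 0 r)
    (hθ0 : 0 ≤ θ) (hθ : (volume Kout).toReal ≤ (1 + θ) * (volume Kin).toReal)
    (hε : ‖(A : E3 →L[ℝ] E3) - R.toLinearIsometry.toContinuousLinearMap‖ ≤ ε)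
    (ha : ‖(A : E3 →L[ℝ] E3)‖ ≤ a)
    (hK : IsCompact K) (hKs : StarConvex ℝ y K)
    (hIK : affMap 0 y A '' Kin ⊆ K) (hKO : K ⊆ affMap 0 y A '' Kout) :
    IsLooseMomentCell K y (a * r * θ) σ
      (δ₁ * a ^ 2 + 3 * |σ₁| * ε * (1 + a) + 3 * |σ₁| * θ + 3 * |σ₁ - σ| + (a * r) ^ 2 * θ)
      (μ₃ * a ^ 3 + (a * r) ^ 3 * θ) (μ₄ * a ^ 4 + (a * r) ^ 4 * θ) := by
  have hKin : IsCompact Kin := hin.1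
  have h0in : (0 : E3) ∈ Kin := hin.2.2.1
  have hδ₁ : 0 ≤ δ₁ := hin.2.2.2.1
  -- the inner image and its exact data
  set I : Set E3 := affMap 0 y A '' Kin with hIdef
  set O : Set E3 := affMap 0 y A '' Kout with hOdef
  have hIc : IsCompact I := hKin.image (continuous_affMap 0 y A)
  have hOc : IsCompact O := hKout.image (continuous_affMap 0 y A)
  have hI : IsMomentCell I y σ₁ (δ₁ * a ^ 2 + 3 * |σ₁| * ε * (1 + a)) (μ₃ * a ^ 3) (μ₄ * a ^ 4) :=
    IsMomentCell.image_affMap hin y A R hε ha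
  obtain ⟨-, -, hyI, hδI, hI1, hI2, hI3, hI4⟩ := hI
  have hεnn : 0 ≤ ε := (norm_nonneg _).trans hε
  have hann : 0 ≤ a := (norm_nonneg _).trans ha
  have hr0 : 0 ≤ r := by
    have := hball (hsub h0in); simpa using this
  have har : 0 ≤ a * r := mul_nonneg hann hr0
  set vK := (volume K).toReal with hvK
  set vI := (volume I).toReal with hvI
  set vO := (volume O).toReal with hvO
  have hvK0 : 0 ≤ vK := ENNReal.toReal_nonneg
  have hvI0 : 0 ≤ vI := ENNReal.toReal_nonneg
  have hIleK : vI ≤ vK := ENNReal.toReal_mono hK.measure_lt_top.ne (measure_mono hIK)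
  have hsl : vO - vI ≤ θ * vK := sliver_volume_le hKin hKout hK y A hθ0 hθ hIK
  have hKmI : vK - vI ≤ θ * vK := by
    have : vK ≤ vO := ENNReal.toReal_mono hOc.measure_lt_top.ne (measure_mono hKO)
    linarith
  -- points of `O` are within `a r` of `y`
  have hptO : ∀ x ∈ O, ‖x - y‖ ≤ a * r := fun x hx =>
    norm_sub_le_of_mem_image_affMap hball y A ha hx
  -- integrability on `K`
  have hsubc : Continuous fun x : E3 => x - y := continuous_id.sub continuous_const
  have iV : IntegrableOn (fun x : E3 => x - y) K := hsubc.continuousOn.integrableOn_compact hK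
  have i3 : IntegrableOn (fun x : E3 => ‖x - y‖ ^ 3) K :=
    ((continuous_norm.comp hsubc).pow 3).continuousOn.integrableOn_compact hK
  have i4 : IntegrableOn (fun x : E3 => ‖x - y‖ ^ 4) K :=
    ((continuous_norm.comp hsubc).pow 4).continuousOn.integrableOn_compact hK
  -- generic sliver estimate on `K`
  have sliver : ∀ {F : Type} [NormedAddCommGroup F] [NormedSpace ℝ F] {h : E3 → F} {M : ℝ},
      IntegrableOn h K → (∀ x ∈ O, ‖h x‖ ≤ M) → 0 ≤ M →
      ‖(∫ x in K, h x) - ∫ x in I, h x‖ ≤ M * (θ * vK) := by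
    intro F _ _ h M hint hM hM0
    have h1 := norm_integral_sub_integral_le_sliver hIc hK hOc.measure_lt_top.ne
      hIK hKO hint hM
    exact h1.trans (mul_le_mul_of_nonneg_left hsl hM0)
  refine ⟨hK, hKs, hIK hyI, by positivity, ?_, ?_, ?_, ?_⟩
  · -- centroid defect
    have h := sliver iV (fun x hx => hptO x hx) har
    rw [hI1, sub_zero] at h
    calc ‖∫ x in K, (x - y)‖ ≤ a * r * (θ * vK) := h
      _ = a * r * θ * vK := by ring
  · -- second-moment form with the nominal `σ`
    intro B
    set T := ∑ i : Fin 3, B (fun _ => e3 i) with hT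
    have hTle : |T| ≤ 3 * ‖B‖ := abs_trace_le B
    have iB : IntegrableOn (fun x : E3 => B (fun _ => x - y)) K :=
      (B.cont.comp (continuous_pi fun _ => hsubc)).continuousOn.integrableOn_compact hK
    have hBpt : ∀ x ∈ O, ‖B (fun _ => x - y)‖ ≤ ‖B‖ * (a * r) ^ 2 := by
      intro x hx
      rw [Real.norm_eq_abs]
      calc |B (fun _ => x - y)| ≤ ‖B‖ * ‖x - y‖ ^ 2 := abs_two_form_diag_le B (x - y)
        _ ≤ ‖B‖ * (a * r) ^ 2 := by gcongr; exact hptO x hx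
    have hS := sliver iB hBpt (by positivity)
    rw [Real.norm_eq_abs] at hS
    have hform : |(∫ x in I, B (fun _ => x - y)) - σ₁ * vI * T|
        ≤ (δ₁ * a ^ 2 + 3 * |σ₁| * ε * (1 + a)) * vI * ‖B‖ := hI2 B
    -- decomposition of the defect
    have key : (∫ x in K, B (fun _ => x - y)) - σ * vK * T
        = ((∫ x in K, B (fun _ => x - y)) - ∫ x in I, B (fun _ => x - y))
          + ((∫ x in I, B (fun _ => x - y)) - σ₁ * vI * T)
          + σ₁ * (vI - vK) * T + (σ₁ - σ) * vK * T := by ring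
    rw [key]
    have t2 : |σ₁ * (vI - vK) * T| ≤ |σ₁| * (θ * vK) * (3 * ‖B‖) := by
      rw [abs_mul, abs_mul]
      have : |vI - vK| ≤ θ * vK := by rw [abs_sub_comm, abs_of_nonneg (by linarith)]; exact hKmI
      gcongr
    have t3 : |(σ₁ - σ) * vK * T| ≤ |σ₁ - σ| * vK * (3 * ‖B‖) := by
      rw [abs_mul, abs_mul, abs_of_nonneg hvK0]
      gcongr
    have hc1 : (δ₁ * a ^ 2 + 3 * |σ₁| * ε * (1 + a)) * vI * ‖B‖
        ≤ (δ₁ * a ^ 2 + 3 * |σ₁| * ε * (1 + a)) * vK * ‖B‖ := by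
      gcongr
    calc |((∫ x in K, B (fun _ => x - y)) - ∫ x in I, B (fun _ => x - y))
          + ((∫ x in I, B (fun _ => x - y)) - σ₁ * vI * T)
          + σ₁ * (vI - vK) * T + (σ₁ - σ) * vK * T|
        ≤ |(∫ x in K, B (fun _ => x - y)) - ∫ x in I, B (fun _ => x - y)|
          + |(∫ x in I, B (fun _ => x - y)) - σ₁ * vI * T|
          + |σ₁ * (vI - vK) * T| + |(σ₁ - σ) * vK * T| := by
          have u1 := abs_add_le (((∫ x in K, B (fun _ => x - y)) - ∫ x in I, B (fun _ => x - y))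
            + ((∫ x in I, B (fun _ => x - y)) - σ₁ * vI * T) + σ₁ * (vI - vK) * T)
            ((σ₁ - σ) * vK * T)
          have u2 := abs_add_le (((∫ x in K, B (fun _ => x - y)) - ∫ x in I, B (fun _ => x - y))
            + ((∫ x in I, B (fun _ => x - y)) - σ₁ * vI * T)) (σ₁ * (vI - vK) * T)
          have u3 := abs_add_le ((∫ x in K, B (fun _ => x - y)) - ∫ x in I, B (fun _ => x - y))
            ((∫ x in I, B (fun _ => x - y)) - σ₁ * vI * T)
          linarith
      _ ≤ ‖B‖ * (a * r) ^ 2 * (θ * vK) + (δ₁ * a ^ 2 + 3 * |σ₁| * ε * (1 + a)) * vK * ‖B‖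
          + |σ₁| * (θ * vK) * (3 * ‖B‖) + |σ₁ - σ| * vK * (3 * ‖B‖) := by
          linarith [hS, hform.trans hc1, t2, t3]
      _ = (δ₁ * a ^ 2 + 3 * |σ₁| * ε * (1 + a) + 3 * |σ₁| * θ + 3 * |σ₁ - σ| + (a * r) ^ 2 * θ)
          * vK * ‖B‖ := by ring
  · -- third absolute moment
    have hpt : ∀ x ∈ O, ‖‖x - y‖ ^ 3‖ ≤ (a * r) ^ 3 := by
      intro x hx
      rw [Real.norm_eq_abs, abs_of_nonneg (by positivity)]
      exact pow_le_pow_left₀ (norm_nonneg _) (hptO x hx) 3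
    have hS := sliver i3 hpt (by positivity)
    rw [Real.norm_eq_abs] at hS
    have hI3' : (∫ x in I, ‖x - y‖ ^ 3) ≤ μ₃ * a ^ 3 * vK :=
      hI3.trans (mul_le_mul_of_nonneg_left hIleK (by positivity))
    have := abs_le.mp hS
    calc (∫ x in K, ‖x - y‖ ^ 3)
        = ((∫ x in K, ‖x - y‖ ^ 3) - ∫ x in I, ‖x - y‖ ^ 3) + ∫ x in I, ‖x - y‖ ^ 3 := by ring
      _ ≤ (a * r) ^ 3 * (θ * vK) + μ₃ * a ^ 3 * vK := by linarith [this.2]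
      _ = (μ₃ * a ^ 3 + (a * r) ^ 3 * θ) * vK := by ring
  · -- fourth absolute moment
    have hpt : ∀ x ∈ O, ‖‖x - y‖ ^ 4‖ ≤ (a * r) ^ 4 := by
      intro x hx
      rw [Real.norm_eq_abs, abs_of_nonneg (by positivity)]
      exact pow_le_pow_left₀ (norm_nonneg _) (hptO x hx) 4
    have hS := sliver i4 hpt (by positivity)
    rw [Real.norm_eq_abs] at hS
    have hI4' : (∫ x in I, ‖x - y‖ ^ 4) ≤ μ₄ * a ^ 4 * vK :=
      hI4.trans (mul_le_mul_of_nonneg_left hIleK (by positivity))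
    have := abs_le.mp hS
    calc (∫ x in K, ‖x - y‖ ^ 4)
        = ((∫ x in K, ‖x - y‖ ^ 4) - ∫ x in I, ‖x - y‖ ^ 4) + ∫ x in I, ‖x - y‖ ^ 4 := by ring
      _ ≤ (a * r) ^ 4 * (θ * vK) + μ₄ * a ^ 4 * vK := by linarith [this.2]
      _ = (μ₄ * a ^ 4 + (a * r) ^ 4 * θ) * vK := by ring

/-- ★ The structured cubic clause of the sandwiched cell: `τ ↦ τa³ + (a r)³θ` (for a `k`-cell take
`τ = 0` via `cubic_clause_of_centrallySymmetric` on the inner rhombic dodecahedron). -/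
theorem cubic_clause_of_sandwich {K Kin Kout : Set E3} {y : E3} {A : E3 ≃L[ℝ] E3}
    {a r θ τ : ℝ} (hKin : IsCompact Kin)
    (hτ0 : 0 ≤ τ)
    (hτ : ∀ B : E3 [×3]→L[ℝ] ℝ, |∫ x in Kin, B (fun _ => x - 0)| ≤ τ * (volume Kin).toReal * ‖B‖)
    (hKout : IsCompact Kout) (hsub : Kin ⊆ Kout) (hball : Kout ⊆ Metric.closedBall 0 r)
    (h0in : (0 : E3) ∈ Kin)
    (hθ0 : 0 ≤ θ) (hθ : (volume Kout).toReal ≤ (1 + θ) * (volume Kin).toReal)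
    (ha : ‖(A : E3 →L[ℝ] E3)‖ ≤ a)
    (hK : IsCompact K) (hIK : affMap 0 y A '' Kin ⊆ K) (hKO : K ⊆ affMap 0 y A '' Kout)
    (B : E3 [×3]→L[ℝ] ℝ) :
    |∫ x in K, B (fun _ => x - y)| ≤ (τ * a ^ 3 + (a * r) ^ 3 * θ) * (volume K).toReal * ‖B‖ := by
  set I : Set E3 := affMap 0 y A '' Kin with hIdef
  set O : Set E3 := affMap 0 y A '' Kout with hOdef
  have hIc : IsCompact I := hKin.image (continuous_affMap 0 y A)
  have hOc : IsCompact O := hKout.image (continuous_affMap 0 y A)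
  have hann : 0 ≤ a := (norm_nonneg _).trans ha
  have hr0 : 0 ≤ r := by have := hball (hsub h0in); simpa using this
  have har : 0 ≤ a * r := mul_nonneg hann hr0
  set vK := (volume K).toReal with hvK
  set vI := (volume I).toReal with hvI
  have hvK0 : 0 ≤ vK := ENNReal.toReal_nonneg
  have hIleK : vI ≤ vK := ENNReal.toReal_mono hK.measure_lt_top.ne (measure_mono hIK)
  have hsl : (volume O).toReal - vI ≤ θ * vK := sliver_volume_le hKin hKout hK y A hθ0 hθ hIK
  have hptO : ∀ x ∈ O, ‖x - y‖ ≤ a * r := fun x hx =>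
    norm_sub_le_of_mem_image_affMap hball y A ha hx
  have hsubc : Continuous fun x : E3 => x - y := continuous_id.sub continuous_const
  have iB : IntegrableOn (fun x : E3 => B (fun _ => x - y)) K :=
    (B.cont.comp (continuous_pi fun _ => hsubc)).continuousOn.integrableOn_compact hK
  have hBpt : ∀ x ∈ O, ‖B (fun _ => x - y)‖ ≤ ‖B‖ * (a * r) ^ 3 := by
    intro x hx
    rw [Real.norm_eq_abs]
    calc |B (fun _ => x - y)| ≤ ‖B‖ * ‖x - y‖ ^ 3 := abs_three_form_diag_le B (x - y)
      _ ≤ ‖B‖ * (a * r) ^ 3 := by gcongr; exact hptO x hx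
  have hS0 := norm_integral_sub_integral_le_sliver hIc hK hOc.measure_lt_top.ne
    hIK hKO iB hBpt
  have hS : |(∫ x in K, B (fun _ => x - y)) - ∫ x in I, B (fun _ => x - y)|
      ≤ ‖B‖ * (a * r) ^ 3 * (θ * vK) := by
    rw [← Real.norm_eq_abs]
    exact hS0.trans (mul_le_mul_of_nonneg_left hsl (by positivity))
  have hIcub : |∫ x in I, B (fun _ => x - y)| ≤ τ * a ^ 3 * vI * ‖B‖ :=
    cubic_clause_image_affMap hKin hτ hτ0 y A ha B
  have hIcub' : |∫ x in I, B (fun _ => x - y)| ≤ τ * a ^ 3 * vK * ‖B‖ := by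
    refine hIcub.trans ?_
    gcongr
  calc |∫ x in K, B (fun _ => x - y)|
      = |((∫ x in K, B (fun _ => x - y)) - ∫ x in I, B (fun _ => x - y))
          + ∫ x in I, B (fun _ => x - y)| := by ring_nf
    _ ≤ |(∫ x in K, B (fun _ => x - y)) - ∫ x in I, B (fun _ => x - y)|
          + |∫ x in I, B (fun _ => x - y)| := abs_add_le _ _
    _ ≤ ‖B‖ * (a * r) ^ 3 * (θ * vK) + τ * a ^ 3 * vK * ‖B‖ := add_le_add hS hIcub'
    _ = (τ * a ^ 3 + (a * r) ^ 3 * θ) * vK * ‖B‖ := by ring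

end

end Summit.AtomisticToContinuum.Crystallization.Theorems.OverbindingBudgetAffineFarFieldCellSandwich
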